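import Summits.QuantumFields.YangMills.Theorems.BalabanUVNodesN15NeumannCubeDivergence
import HarnessLib

/-!
# Route «BalabanUVNodes» (K3⁷), node N15 = NE2, -a lane, PROGRAMME N file N-IIf: THE BARE CUBE PROPAGATOR's METHOD-OF-IMAGES KERNEL (no output cut) and THE ADJOINT-DIFFERENCE
# OUTPUT CUT ROW `χ_□ ∘ ∇*_μ ∘ G(□ + c)` at both spacings (dag-n15-c's (β) — corrected — and (α) of INBOX l.28577)

Cell `pub-ymgap`, seat `pub-ymgap-dag-n15-a` (KNIT-BY-NAME, g19; D-0062; chair R424 venue; `bears_on: R4∕N15`); `--kind proof --supports stmt-QuantumFields-20544 --as helper`.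
Sequel of N-IId `…N15NeumannCubeDivergence`.  CONSUMER: dag-n15-c FILE 63 `…TwoSpacingGluingCutRows` (rows `hN1` = (β), `hDbc μ` = (α)) → FILE 57∕58 → FILE 50.

WHAT.  §20 ★★ `hasMaj_reflSet_comp_images` (`R_T ∘ X ≤ A(y′)·Ce^{δ}·e^{−δ|reflBlk_T y − y′|}`: a multi-reflection moves the OUTPUT block to its image; the bond twist costs `e^{δ}`),
`hasMaj_symOp_comp_images`, ★★★ `hasMaj_neumannCubeG_images_of` (ANY torus∕spacing: from `G ≤ Ce^{−δ₀d}`, the bare `G(□ + c) = Sym∘G∘M_{χ°}` — the symmetric extension — has the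
METHOD-OF-IMAGES kernel `1_□(y′)·Ce^{δ₀}·Σ_{T ⊆ {0..d}} e^{−δ₀|reflBlk_T y − y′|_T}`: `2^{d+1}` bumps at the images of the output block; for `y ∈ □` it collapses to N-IIIb's two-sided row,
at a mirror image of `y′` it is `O(1)` — so dag-n15-c's (β) «`neumannCubeG ≤ 1_□(y′)β′e^{−δd}`» holds ONLY behind an output cut), ★★ `hasMaj_neumannCubeG_images_pair` (torus family, both
spacings, uniform `δ, β`).  §21 `symbOp_divAdj_eq_neg_bshiftV` (`∇*_μ = −S_{−μ}∇_μ`, so dag-n15-c's `bgrad = S_{−μ}∇_μ = −∇*_μ`), `mulOp_comp_divAdj_comp_symOp_comp`,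
★★ `hasMaj_chiCube_divAdjOut_neumannCubeG_of` (ANY torus∕spacing: from `∇_μG ≤ Ce^{−δ₀d}`, `χ_□ ∘ ∇*_μ ∘ G(□ + c) ≤ 1_□1_□·2^{d+1}Ce^{2δ₀}·e^{−δ₀d}` — per image N-IId's
`∇*_μ∘R_T = R_T∘∇*_μ` or `R_T∘∇_μ`, the shifted entry costing `e^{δ₀}`), ★★ `hasMaj_chiCube_divAdjOut_neumannCubeG_pair` (torus family, both spacings = dag-n15-c's `hDbc μ` up to
`HasMaj.neg`).
HONEST FRAMING.  Block-majorant bookkeeping over the LANDED (1.110) torus letters; no new analytic estimate; `U ≡ 1` torus MODEL on the doubled-cube family (one-cube model — ref-B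
OBSERVATION-2∕CAUTION-P (4)); nothing of [B6]∕[B9] asserted; N15 NOT discharged (object-bound; NE2⁺ NOT PRINTED); counts UNMOVED (typed 28∕28 · discharged 5∕27); one finite torus pair
per index — NOT continuum ∕ ℝ⁴ ∕ OS ∕ mass gap ∕ Clay.  Theorems only (0 `def`).
-/

noncomputable section

open scoped BigOperators Matrix
open Finset

namespace Summit.QuantumFields.YangMills.BalabanUVNodes.N15.TwoGrid

open Literature.MathematicalPhysics.QuantumFieldTheory.Balaban1983to89
open Literature.MathematicalPhysics.QuantumFieldTheory.Balaban1983to89.B5Prop11Plancherel (Tor fine unitVec)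
open Literature.MathematicalPhysics.QuantumFieldTheory.Balaban1983to89.B5Block118 (up bpt)
open Literature.MathematicalPhysics.QuantumFieldTheory.Balaban1983to89.B6Prop26Gluing (mulOp mulOp_apply ind ind_nonneg ind_le_one)
open Literature.MathematicalPhysics.QuantumFieldTheory.King1986.Torus (blockOf tdistT tdistT_symm tdistT_self tdistT_triangle tdistT_nonneg)
open Literature.MathematicalPhysics.QuantumFieldTheory.Balaban1983to89.B11SectG (BlockNorm HasMaj)
open Literature.MathematicalPhysics.QuantumFieldTheory.Balaban1983to89.B6UnitTorusCarrier (unitTorusGeo)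
open Literature.MathematicalPhysics.QuantumFieldTheory.Balaban1983to89.B5SiteBridgeP12 (MP)
open Literature.MathematicalPhysics.QuantumFieldTheory.Balaban1983to89.B5SettingP12Real (latticeSettingP12R)
open Summit.QuantumFields.YangMills.BalabanUVNodes.N15.VectorPiece (blkFine bshiftV bshiftV_apply hasMaj_bshiftV_comp tdistT_blockOf_sub_unitVec_le)

variable {d : ℕ}

/-! ## §20 THE BARE CUBE PROPAGATOR HAS THE METHOD-OF-IMAGES KERNEL (no output cut): `G(□ + c) ≤ 1_□(y′)·Ce^{δ}·Σ_T e^{−δ|img_T y − y′|}` -/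

section Images

open Literature.MathematicalPhysics.QuantumFieldTheory.Balaban1983to89.B11AxialTransport190 (abs_le_loc_ofBlocks loc_ofBlocks_le)

variable {L : ℕ} {M : Fin (d + 1) → ℕ} [∀ μ, NeZero (M μ)] {k n : ℕ} [NeZero n] {c : Tor M} {S : ℕ}

/-- ★★ **A MULTI-REFLECTION MOVES THE OUTPUT BLOCK TO ITS IMAGE** (no output cut): from `X ≤ A(y′)·C·e^{−δ|y−y′|}`, `R_T ∘ X ≤ A(y′)·Ce^{δ}·e^{−δ|reflBlk_T y − y′|}` (the bond twist may move
the image into a neighbouring block: cost `e^{δ}`). [cite: Balaban1984PropagatorsII, (2.37) p.229 (method of images)] -/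
theorem hasMaj_reflSet_comp_images {F₁ : Type} [AddCommGroup F₁] [Module ℝ F₁] {b₁ : BlockNorm (unitTorusGeo L k M) F₁}
    {X : F₁ →ₗ[ℝ] (Tor (fine n M) × Fin (d + 1) → ℝ)} {A : Tor M → ℝ} {C δ : ℝ} (hA : ∀ y', 0 ≤ A y') (hC : 0 ≤ C) (hδ : 0 ≤ δ) (T : Finset (Fin (d + 1)))
    (hX : HasMaj b₁ (BlockNorm.ofBlocks (unitTorusGeo L k M) (fun b : Tor (fine n M) × Fin (d + 1) => blockOf n M b.1)) X
      (fun y y' => A y' * (C * Real.exp (-(δ * tdistT M y y'))))) :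
    HasMaj b₁ (BlockNorm.ofBlocks (unitTorusGeo L k M) (fun b : Tor (fine n M) × Fin (d + 1) => blockOf n M b.1)) (reflSet M n c T ∘ₗ X)
      (fun y y' => A y' * (C * Real.exp δ * Real.exp (-(δ * tdistT M (reflBlk M c T y) y')))) := by
  classical
  intro y' μ hμ y
  dsimp only
  set blk := fun b : Tor (fine n M) × Fin (d + 1) => blockOf n M b.1 with hblk
  have hRHS : 0 ≤ A y' * (C * Real.exp δ * Real.exp (-(δ * tdistT M (reflBlk M c T y) y'))) * b₁.loc y' μ :=
    mul_nonneg (mul_nonneg (hA y') (by positivity)) (b₁.loc_nonneg y' μ)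
  refine loc_ofBlocks_le (g := unitTorusGeo L k M) blk _ hRHS fun b hb => ?_
  rw [LinearMap.comp_apply, reflSet_apply]
  have h1 : |sgnT M n T b * X μ (imgBond M n c T b)| ≤ |X μ (imgBond M n c T b)| := by
    rw [abs_mul]
    have hs : |sgnT M n T b| = 1 := by unfold sgnT; split_ifs <;> simp
    rw [hs, one_mul]
  refine h1.trans ((abs_le_loc_ofBlocks (g := unitTorusGeo L k M) blk (X μ) rfl).trans ((hX y' μ hμ (blk (imgBond M n c T b))).trans ?_))
  dsimp only
  refine mul_le_mul_of_nonneg_right (mul_le_mul_of_nonneg_left ?_ (hA y')) (b₁.loc_nonneg y' μ)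
  rw [mul_assoc]
  refine mul_le_mul_of_nonneg_left ?_ hC
  rw [← Real.exp_add]
  refine Real.exp_le_exp.mpr ?_
  -- the image bond's block is within one block of the image block
  have hb' : blockOf n M b.1 = y := hb
  have himg : blockOf n M (imgPt M n c T b.1) = reflBlk M c T y := by rw [blockOf_imgPt, hb']
  have hnear : tdistT M (reflBlk M c T y) (blockOf n M (imgBond M n c T b).1) ≤ 1 := by
    simp only [imgBond]
    split_ifs with hμT
    · rw [← himg, tdistT_symm]; exact tdistT_blockOf_sub_unitVec_le n M (imgPt M n c T b.1) b.2
    · rw [sub_zero, himg, tdistT_self]; exact zero_le_one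
  have htri := tdistT_triangle M (reflBlk M c T y) (blockOf n M (imgBond M n c T b).1) y'
  nlinarith [tdistT_nonneg M (reflBlk M c T y) y']

/-- ★★ THE SYMMETRISED OPERATOR WITHOUT OUTPUT CUT: the images kernel `A(y′)·Ce^{δ}·Σ_T e^{−δ|reflBlk_T y − y′|}`. [cite: Balaban1984PropagatorsII, (2.37) p.229] -/
theorem hasMaj_symOp_comp_images {F₁ : Type} [AddCommGroup F₁] [Module ℝ F₁] {b₁ : BlockNorm (unitTorusGeo L k M) F₁}
    {X : F₁ →ₗ[ℝ] (Tor (fine n M) × Fin (d + 1) → ℝ)} {A : Tor M → ℝ} {C δ : ℝ} (hA : ∀ y', 0 ≤ A y') (hC : 0 ≤ C) (hδ : 0 ≤ δ)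
    (hX : HasMaj b₁ (BlockNorm.ofBlocks (unitTorusGeo L k M) (fun b : Tor (fine n M) × Fin (d + 1) => blockOf n M b.1)) X
      (fun y y' => A y' * (C * Real.exp (-(δ * tdistT M y y'))))) :
    HasMaj b₁ (BlockNorm.ofBlocks (unitTorusGeo L k M) (fun b : Tor (fine n M) × Fin (d + 1) => blockOf n M b.1)) (symOp M n c ∘ₗ X)
      (fun y y' => A y' * (C * Real.exp δ * ∑ T ∈ (Finset.univ : Finset (Fin (d + 1))).powerset, Real.exp (-(δ * tdistT M (reflBlk M c T y) y')))) := by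
  rw [symOp, fsum_comp]
  refine (hasMaj_finsum _ _ _ fun T _ => hasMaj_reflSet_comp_images hA hC hδ T hX).mono fun y y' => le_of_eq ?_
  rw [Finset.mul_sum, Finset.mul_sum]

/-- ★★★ **THE BARE NEUMANN CUBE PROPAGATOR = SYMMETRIC EXTENSION: THE METHOD-OF-IMAGES KERNEL** (one-sided source localization, NO output cut, any torus∕spacing): from the torus letter
`G ≤ Ce^{−δ₀d}`, `G(□ + c) ≤ 1_□(y′)·Ce^{δ₀}·Σ_{T ⊆ {0..d}} e^{−δ₀|reflBlk_T y − y′|_T}` — `2^{d+1}` bumps centred at the images of the output block; for `y ∈ □` it collapses to N-IIIb's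
two-sided letter (mirror images are farther), for `y` at a mirror image of `y′` it is `O(1)`: a kernel `1_□(y′)·β′e^{−δ|y−y′|}` with `β′` uniform in the cube size does NOT hold.
[cite: Balaban1984PropagatorsII, (2.37) p.229 (images); Balaban1984PropagatorsI, Prop. 1.2 (1.110) p.35] -/
theorem hasMaj_neumannCubeG_images_of {a C δ₀ : ℝ} (hC : 0 ≤ C) (hδ₀ : 0 ≤ δ₀)
    (hG : HasMaj (BlockNorm.ofBlocks (unitTorusGeo L k M) (fun b : Tor (fine n M) × Fin (d + 1) => blockOf n M b.1))
      (BlockNorm.ofBlocks (unitTorusGeo L k M) (fun b : Tor (fine n M) × Fin (d + 1) => blockOf n M b.1)) (gOp M n a) (fun y y' => C * Real.exp (-(δ₀ * tdistT M y y')))) :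
    HasMaj (BlockNorm.ofBlocks (unitTorusGeo L k M) (fun b : Tor (fine n M) × Fin (d + 1) => blockOf n M b.1))
      (BlockNorm.ofBlocks (unitTorusGeo L k M) (fun b : Tor (fine n M) × Fin (d + 1) => blockOf n M b.1)) (neumannCubeG M n c S a)
      (fun y y' => ind (cubeBlocks M c S : Set (Tor M)) y' *
        (C * Real.exp δ₀ * ∑ T ∈ (Finset.univ : Finset (Fin (d + 1))).powerset, Real.exp (-(δ₀ * tdistT M (reflBlk M c T y) y')))) :=
  hasMaj_symOp_comp_images (fun _ => ind_nonneg _ _) hC hδ₀ (hasMaj_comp_mulOp_chiInt (c := c) (S := S) hC hG)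

variable [NeZero L]

/-- ★★ the images letter of the bare cube propagators of the torus family, BOTH spacings, uniform constants. [cite: Balaban1984PropagatorsII, (2.37) p.229; Balaban1984PropagatorsI, Prop. 1.2 (1.110) p.35] -/
theorem hasMaj_neumannCubeG_images_pair (hL : Odd L ∧ 1 < L) {a : ℝ} (ha : 0 < a) :
    ∃ δ β : ℝ, 0 < δ ∧ 0 < β ∧ ∀ (mT k r : ℕ) (hk : 1 ≤ k) (c : Tor (MP (paramsOf d L mT k hL))),
      HasMaj (BlockNorm.ofBlocks (unitTorusGeo L k (MP (paramsOf d L mT k hL))) (blkFine L k (MP (paramsOf d L mT k hL))))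
          (BlockNorm.ofBlocks (unitTorusGeo L k (MP (paramsOf d L mT k hL))) (blkFine L k (MP (paramsOf d L mT k hL))))
          (neumannCubeG (MP (paramsOf d L mT k hL)) (L ^ k) c (L ^ mT) a)
          (fun y y' => ind ((cubeBlocks (MP (paramsOf d L mT k hL)) c (L ^ mT) : Finset _) : Set _) y' *
            (β * ∑ T ∈ (Finset.univ : Finset (Fin (d + 1))).powerset, Real.exp (-(δ * tdistT (MP (paramsOf d L mT k hL)) (reflBlk (MP (paramsOf d L mT k hL)) c T y) y')))) ∧
        HasMaj (BlockNorm.ofBlocks (unitTorusGeo L k (MP (paramsOf d L mT k hL)))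
            (fun i : Tor (fine (L ^ r * L ^ k) (MP (paramsOf d L mT k hL))) × Fin (d + 1) => blockOf (L ^ r * L ^ k) (MP (paramsOf d L mT k hL)) i.1))
          (BlockNorm.ofBlocks (unitTorusGeo L k (MP (paramsOf d L mT k hL)))
            (fun i : Tor (fine (L ^ r * L ^ k) (MP (paramsOf d L mT k hL))) × Fin (d + 1) => blockOf (L ^ r * L ^ k) (MP (paramsOf d L mT k hL)) i.1))
          (neumannCubeG (MP (paramsOf d L mT k hL)) (L ^ r * L ^ k) c (L ^ mT) a)
          (fun y y' => ind ((cubeBlocks (MP (paramsOf d L mT k hL)) c (L ^ mT) : Finset _) : Set _) y' *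
            (β * ∑ T ∈ (Finset.univ : Finset (Fin (d + 1))).powerset, Real.exp (-(δ * tdistT (MP (paramsOf d L mT k hL)) (reflBlk (MP (paramsOf d L mT k hL)) c T y) y')))) := by
  obtain ⟨δ₀, C, Cα, Cε, Cαε, hδ₀, hC, H⟩ := ineq110_114_pair (d := d) hL ha
  refine ⟨δ₀, C * Real.exp δ₀, hδ₀, by positivity, fun mT k r hk c => ⟨?_, ?_⟩⟩
  · have hn : 1 ≤ L ^ k := Nat.one_le_pow _ _ (Nat.pos_of_ne_zero (NeZero.ne L))
    exact hasMaj_neumannCubeG_images_of hC.le hδ₀.le (hasMaj_gOp_of_ineq (L := L) (k := k) _ _ a hn (H mT k r hk).1 hC.le)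
  · have hn' : 1 ≤ L ^ r * L ^ k := Nat.one_le_iff_ne_zero.mpr (Nat.mul_ne_zero (pow_ne_zero r (NeZero.ne L)) (pow_ne_zero k (NeZero.ne L)))
    exact hasMaj_neumannCubeG_images_of hC.le hδ₀.le (hasMaj_gOp_of_ineq (L := L) (k := k) _ _ a hn' (H mT k r hk).2 hC.le)

end Images

/-! ## §21 THE BACKWARD∕ADJOINT OUTPUT CUT ROW `χ_□ ∘ ∇*_μ ∘ G(□ + c)` (dag-n15-c's (α): `bgrad = S_{−μ}∇_μ = −∇*_μ`) -/

section OutputRows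

variable {L : ℕ} {M : Fin (d + 1) → ℕ} [∀ μ, NeZero (M μ)] {k n : ℕ} [NeZero n] {c : Tor M} {S : ℕ}

omit [∀ μ, NeZero (M μ)] [NeZero n] in
/-- `∇*_μ = −S_{−μ}∇_μ` (`ρ(n•(s_μ⁻¹ − 1)) = −(S_{−μ} ∘ ρ(n(s_μ − 1)))`). [cite: Balaban1984PropagatorsI, (1.3) p.18 (lattice derivatives)] -/
theorem symbOp_divAdj_eq_neg_bshiftV (μ : Fin (d + 1)) (cc : ℝ) : symbOp M n (cc • (sTinv M n μ - 1)) = -(bshiftV M n μ ∘ₗ symbOp M n (sD M n μ cc)) := by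
  refine LinearMap.ext fun f => funext fun b => ?_
  simp only [symbOp_divAdj_apply, LinearMap.neg_apply, Pi.neg_apply, LinearMap.comp_apply, bshiftV_apply, symbOp_sD_apply, sub_add_cancel]
  ring

omit [∀ μ, NeZero (M μ)] [NeZero n] in
/-- `χ ∘ ∇*_μ ∘ Sym ∘ Y` is the sum of the reflected pieces `χ ∘ ∇*_μ ∘ R_T ∘ Y`. [folklore] -/
theorem mulOp_comp_divAdj_comp_symOp_comp {F₁ : Type} [AddCommGroup F₁] [Module ℝ F₁] (Y : F₁ →ₗ[ℝ] (Tor (fine n M) × Fin (d + 1) → ℝ))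
    (χ : Tor (fine n M) × Fin (d + 1) → ℝ) (μ : Fin (d + 1)) (cc : ℝ) :
    mulOp χ ∘ₗ symbOp M n (cc • (sTinv M n μ - 1)) ∘ₗ symOp M n c ∘ₗ Y =
      ∑ T ∈ (Finset.univ : Finset (Fin (d + 1))).powerset, mulOp χ ∘ₗ symbOp M n (cc • (sTinv M n μ - 1)) ∘ₗ reflSet M n c T ∘ₗ Y := by
  refine LinearMap.ext fun f => ?_
  simp only [symOp, LinearMap.comp_apply, LinearMap.sum_apply, map_sum]

/-- ★★ **THE ADJOINT-DIFFERENCE OUTPUT CUT ROW AT ANY SPACING** (dag-n15-c's (α), up to the sign `bgrad_μ = −∇*_μ`): from the torus letter `∇_μG ≤ Ce^{−δ₀d}`,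
`χ_□ ∘ ∇*_μ ∘ G(□ + c) ≤ 1_□1_□·2^{d+1}Ce^{2δ₀}·e^{−δ₀d}` — per image `∇*_μ∘R_T = R_T∘∇*_μ` (`μ ∉ T`, and `∇*_μG = −S_{−μ}∇_μG` costs `e^{δ₀}`) or `R_T∘∇_μ` (`μ ∈ T`).
[cite: Balaban1984PropagatorsII, (2.133) p.247 (shape), (2.37) p.229; Balaban1984PropagatorsI, Prop. 1.2 (1.110) p.35] -/
theorem hasMaj_chiCube_divAdjOut_neumannCubeG_of (hM : ∀ ν, M ν = 2 * S) {a C δ₀ : ℝ} (hC : 0 ≤ C) (hδ₀ : 0 ≤ δ₀) (μ : Fin (d + 1))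
    (hD : HasMaj (BlockNorm.ofBlocks (unitTorusGeo L k M) (fun b : Tor (fine n M) × Fin (d + 1) => blockOf n M b.1))
      (BlockNorm.ofBlocks (unitTorusGeo L k M) (fun b : Tor (fine n M) × Fin (d + 1) => blockOf n M b.1))
      (symbOp M n (sD M n μ (n : ℝ)) ∘ₗ gOp M n a) (fun y y' => C * Real.exp (-(δ₀ * tdistT M y y')))) :
    HasMaj (BlockNorm.ofBlocks (unitTorusGeo L k M) (fun b : Tor (fine n M) × Fin (d + 1) => blockOf n M b.1))
      (BlockNorm.ofBlocks (unitTorusGeo L k M) (fun b : Tor (fine n M) × Fin (d + 1) => blockOf n M b.1))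
      (mulOp (chiCube M n c S) ∘ₗ symbOp M n ((n : ℝ) • (sTinv M n μ - 1)) ∘ₗ neumannCubeG M n c S a)
      (fun y y' => ind (cubeBlocks M c S : Set (Tor M)) y * ind (cubeBlocks M c S : Set (Tor M)) y' *
        (2 ^ (d + 1) * (C * Real.exp δ₀ * Real.exp δ₀) * Real.exp (-(δ₀ * tdistT M y y')))) := by
  have hCe : 0 ≤ C * Real.exp δ₀ := by positivity
  have he1 : 1 ≤ Real.exp δ₀ := Real.one_le_exp hδ₀
  -- the two inner letters, source-localized: `∇_μ G χ°` and `∇*_μ G χ° = −S_{−μ}∇_μ G χ°`, both `≤ 1_□(y′)·Ce^{δ₀}e^{−δ₀d}`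
  have hIn1 : HasMaj (BlockNorm.ofBlocks (unitTorusGeo L k M) (fun b : Tor (fine n M) × Fin (d + 1) => blockOf n M b.1))
      (BlockNorm.ofBlocks (unitTorusGeo L k M) (fun b : Tor (fine n M) × Fin (d + 1) => blockOf n M b.1))
      ((symbOp M n (sD M n μ (n : ℝ)) ∘ₗ gOp M n a) ∘ₗ mulOp (chiInt M n c S))
      (fun y y' => ind (cubeBlocks M c S : Set (Tor M)) y' * (C * Real.exp δ₀ * Real.exp (-(δ₀ * tdistT M y y')))) :=
    hasMaj_comp_mulOp_chiInt (c := c) (S := S) hCe (hD.mono fun y y' => mul_le_mul_of_nonneg_right (le_mul_of_one_le_right hC he1) (Real.exp_nonneg _))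
  have hIn2 : HasMaj (BlockNorm.ofBlocks (unitTorusGeo L k M) (fun b : Tor (fine n M) × Fin (d + 1) => blockOf n M b.1))
      (BlockNorm.ofBlocks (unitTorusGeo L k M) (fun b : Tor (fine n M) × Fin (d + 1) => blockOf n M b.1))
      ((-(bshiftV M n μ ∘ₗ (symbOp M n (sD M n μ (n : ℝ)) ∘ₗ gOp M n a))) ∘ₗ mulOp (chiInt M n c S))
      (fun y y' => ind (cubeBlocks M c S : Set (Tor M)) y' * (C * Real.exp δ₀ * Real.exp (-(δ₀ * tdistT M y y')))) :=
    hasMaj_comp_mulOp_chiInt (c := c) (S := S) hCe (hasMaj_bshiftV_comp M k n hC hδ₀ μ hD).neg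
  rw [neumannCubeG, mulOp_comp_divAdj_comp_symOp_comp]
  refine (hasMaj_finsum _ _ (fun _ => fun y y' => ind (cubeBlocks M c S : Set (Tor M)) y * ind (cubeBlocks M c S : Set (Tor M)) y' *
      (C * Real.exp δ₀ * Real.exp δ₀ * Real.exp (-(δ₀ * tdistT M y y')))) fun T _ => ?_).mono fun y y' => le_of_eq ?_
  · by_cases hμT : μ ∈ T
    · have e : mulOp (chiCube M n c S) ∘ₗ symbOp M n ((n : ℝ) • (sTinv M n μ - 1)) ∘ₗ reflSet M n c T ∘ₗ gOp M n a ∘ₗ mulOp (chiInt M n c S) =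
          mulOp (chiCube M n c S) ∘ₗ reflSet M n c T ∘ₗ ((symbOp M n (sD M n μ (n : ℝ)) ∘ₗ gOp M n a) ∘ₗ mulOp (chiInt M n c S)) := by
        refine LinearMap.ext fun f => ?_
        have h1 := LinearMap.congr_fun (symbOp_divAdj_comp_reflSet_of_mem (c := c) hμT (n : ℝ)) (gOp M n a (mulOp (chiInt M n c S) f))
        simp only [LinearMap.comp_apply] at h1 ⊢
        rw [h1]
      rw [e]
      exact hasMaj_chiCube_reflSet_comp hCe hδ₀ hM T hIn1
    · have e : mulOp (chiCube M n c S) ∘ₗ symbOp M n ((n : ℝ) • (sTinv M n μ - 1)) ∘ₗ reflSet M n c T ∘ₗ gOp M n a ∘ₗ mulOp (chiInt M n c S) =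
          mulOp (chiCube M n c S) ∘ₗ reflSet M n c T ∘ₗ ((-(bshiftV M n μ ∘ₗ (symbOp M n (sD M n μ (n : ℝ)) ∘ₗ gOp M n a))) ∘ₗ mulOp (chiInt M n c S)) := by
        refine LinearMap.ext fun f => ?_
        have h1 := LinearMap.congr_fun (symbOp_divAdj_comp_reflSet_of_not_mem (c := c) hμT (n : ℝ)) (gOp M n a (mulOp (chiInt M n c S) f))
        have h2 := LinearMap.congr_fun (symbOp_divAdj_eq_neg_bshiftV (M := M) (n := n) μ (n : ℝ)) (gOp M n a (mulOp (chiInt M n c S) f))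
        simp only [LinearMap.comp_apply, LinearMap.neg_apply] at h1 h2 ⊢
        rw [h1, h2, map_neg]
      rw [e]
      exact hasMaj_chiCube_reflSet_comp hCe hδ₀ hM T hIn2
  · rw [Finset.sum_const, Finset.card_powerset, Finset.card_univ, Fintype.card_fin, nsmul_eq_mul]
    push_cast
    ring

variable [NeZero L]

/-- ★★ **THE ADJOINT-DIFFERENCE OUTPUT CUT ROWS OF THE TORUS FAMILY, BOTH SPACINGS** (dag-n15-c's `hDbc μ`, coarse in King's blocks and fine in the blocks read through the pairing), uniform
`δ, β`. [cite: Balaban1984PropagatorsII, (2.133) p.247 (shape); Balaban1984PropagatorsI, Prop. 1.2 (1.110) p.35] -/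
theorem hasMaj_chiCube_divAdjOut_neumannCubeG_pair (hL : Odd L ∧ 1 < L) {a : ℝ} (ha : 0 < a) :
    ∃ δ β : ℝ, 0 < δ ∧ 0 < β ∧ ∀ (mT k r : ℕ) (hk : 1 ≤ k) (c : Tor (MP (paramsOf d L mT k hL))) (μ : Fin (d + 1)),
      HasMaj (BlockNorm.ofBlocks (unitTorusGeo L k (MP (paramsOf d L mT k hL))) (blkFine L k (MP (paramsOf d L mT k hL))))
          (BlockNorm.ofBlocks (unitTorusGeo L k (MP (paramsOf d L mT k hL))) (blkFine L k (MP (paramsOf d L mT k hL))))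
          (mulOp (chiCube (MP (paramsOf d L mT k hL)) (L ^ k) c (L ^ mT)) ∘ₗ
            symbOp (MP (paramsOf d L mT k hL)) (L ^ k) (((L ^ k : ℕ) : ℝ) • (sTinv (MP (paramsOf d L mT k hL)) (L ^ k) μ - 1)) ∘ₗ
              neumannCubeG (MP (paramsOf d L mT k hL)) (L ^ k) c (L ^ mT) a)
          (fun y y' => ind ((cubeBlocks (MP (paramsOf d L mT k hL)) c (L ^ mT) : Finset _) : Set _) y *
            ind ((cubeBlocks (MP (paramsOf d L mT k hL)) c (L ^ mT) : Finset _) : Set _) y' * (β * Real.exp (-(δ * tdistT (MP (paramsOf d L mT k hL)) y y')))) ∧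
        HasMaj (BlockNorm.ofBlocks (unitTorusGeo L k (MP (paramsOf d L mT k hL)))
            (fun i : Tor (fine (L ^ r * L ^ k) (MP (paramsOf d L mT k hL))) × Fin (d + 1) => blockOf (L ^ r * L ^ k) (MP (paramsOf d L mT k hL)) i.1))
          (BlockNorm.ofBlocks (unitTorusGeo L k (MP (paramsOf d L mT k hL)))
            (fun i : Tor (fine (L ^ r * L ^ k) (MP (paramsOf d L mT k hL))) × Fin (d + 1) => blockOf (L ^ r * L ^ k) (MP (paramsOf d L mT k hL)) i.1))
          (mulOp (chiCube (MP (paramsOf d L mT k hL)) (L ^ r * L ^ k) c (L ^ mT)) ∘ₗ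
            symbOp (MP (paramsOf d L mT k hL)) (L ^ r * L ^ k) (((L ^ r * L ^ k : ℕ) : ℝ) • (sTinv (MP (paramsOf d L mT k hL)) (L ^ r * L ^ k) μ - 1)) ∘ₗ
              neumannCubeG (MP (paramsOf d L mT k hL)) (L ^ r * L ^ k) c (L ^ mT) a)
          (fun y y' => ind ((cubeBlocks (MP (paramsOf d L mT k hL)) c (L ^ mT) : Finset _) : Set _) y *
            ind ((cubeBlocks (MP (paramsOf d L mT k hL)) c (L ^ mT) : Finset _) : Set _) y' * (β * Real.exp (-(δ * tdistT (MP (paramsOf d L mT k hL)) y y')))) := by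
  obtain ⟨δ₀, C, Cα, Cε, Cαε, hδ₀, hC, H⟩ := ineq110_114_pair (d := d) hL ha
  refine ⟨δ₀, 2 ^ (d + 1) * (C * Real.exp δ₀ * Real.exp δ₀), hδ₀, by positivity, fun mT k r hk c μ => ⟨?_, ?_⟩⟩
  · have hn : 1 ≤ L ^ k := Nat.one_le_pow _ _ (Nat.pos_of_ne_zero (NeZero.ne L))
    exact hasMaj_chiCube_divAdjOut_neumannCubeG_of (fun ν => rfl) hC.le hδ₀.le μ (hasMaj_grad_of_ineq (L := L) (k := k) _ _ a hn (H mT k r hk).1 hC.le μ)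
  · have hn' : 1 ≤ L ^ r * L ^ k := Nat.one_le_iff_ne_zero.mpr (Nat.mul_ne_zero (pow_ne_zero r (NeZero.ne L)) (pow_ne_zero k (NeZero.ne L)))
    exact hasMaj_chiCube_divAdjOut_neumannCubeG_of (fun ν => rfl) hC.le hδ₀.le μ (hasMaj_grad_of_ineq (L := L) (k := k) _ _ a hn' (H mT k r hk).2 hC.le μ)

end OutputRows

end Summit.QuantumFields.YangMills.BalabanUVNodes.N15.TwoGrid
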